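import Mathlib
import HarnessLib
import Summits.MatrixMultiplication.MatrixMultiplication.Theorems.FarEdgeDescentFloorDial
import Summits.MatrixMultiplication.MatrixMultiplication.Theorems.FarEdgeDescentNarrownessPotential

/-!
# Far-edge descent, kernel XLII-E — the neutral strip of the region criterion, analytically (model level)

The region criterion of kernel XLII-C (`RegionCriterion β z ε Vmin κ`) asks, for every pinned pair, that
`A·x^κ + B·(1−x)^κ ≤ RHS` for all `x ∈ [0,1]`, where `A = (1−(β−1)λ')·λ(ε+1−V)`,
`B = (1−(β−1)λ)·λ'(ε+1−V')`, `RHS = (λ+λ'−(2β−1)λλ')·(ε+1−V_P)`.  Its supremum over the region is `1·RHS`,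
approached (never attained) in the NEUTRAL LIMIT `λ' → 0`, so no finite cell decomposition can certify it
near that boundary.  THIS FILE supplies the analytic treatment of the neutral strip:

* `neutral_identity`: `RHS − A = λ'·c` EXACTLY, `c = (1−βλ)(ε+1−V') + λV(1−zV')` (a ring identity through
  the product rule), and `neutral_coeff_pos`: `c ≥ (1−βλ)ε + λV(1−z) > 0` on the region;
* `rpow_tangent` (concavity of `s ↦ s^κ`, `0 ≤ κ ≤ 1`, from Bernoulli): `s^κ ≤ (1−κ)s₀^κ + κ s₀^{κ−1} s`;
* `strip_bound`: if `B ≤ A·s₀^{1−κ}` and `(1−κ)·B·s₀^κ ≤ m` for some `s₀ > 0`, then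
  `A x^κ + B(1−x)^κ ≤ A + m` for all `x ∈ [0,1]`;
* `criterion_pair_of_strip`: hence the criterion's conclusion holds for every pair admitting such an `s₀`
  with `m = λ'·c` — an explicit neighbourhood of the neutral boundary (`B = O(λ')`, `A ≍ λ`, so any
  `s₀` with `λ'·b ≤ A s₀^{1−κ}`, `(1−κ) b s₀^κ ≤ c` works: a cone `λ' ≲ λ^{1/(1−κ)}`-free choice per cell).
A certification of `RegionCriterion` (memo g62 §5, g63) = this lemma on the strip + finitely many cells away
from it.  MODEL level; no `sorry`, no new axioms, no new definitions.  References: memo g62 §2.4; kernels XLII-C/D.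
-/

noncomputable section

set_option linter.dupNamespace false

namespace Summit.MatrixMultiplication.MatrixMultiplication.Theorems.FarEdgeDescentNeutralMargin

open Real

/-! ## The exact first-order identity at the neutral boundary -/

/-- `RHS − A = λ'·c` identically, given the product rule for `V_P`. -/
theorem neutral_identity {β z ε lam lam' V V' VP : ℝ}
    (hP : VP * (lam + lam' - (2 * β - 1) * lam * lam') =
      lam' * (1 - β * lam) * V' + lam * (1 - β * lam') * V + z * lam * lam' * V * V') :
    (lam + lam' - (2 * β - 1) * lam * lam') * (ε + 1 - VP) -
        (1 - (β - 1) * lam') * (lam * (ε + 1 - V)) =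
      lam' * ((1 - β * lam) * (ε + 1 - V') + lam * V * (1 - z * V')) := by
  linear_combination (-1 : ℝ) * hP

/-- The neutral coefficient is bounded below by `(1−βλ)ε + λV(1−z)` … -/
theorem neutral_coeff_ge {β z ε lam V V' : ℝ} (hl : β * lam ≤ 1) (hl0 : 0 ≤ lam) (hV : 0 ≤ V)
    (hV'1 : V' ≤ 1) (hz : 0 ≤ z) :
    (1 - β * lam) * ε + lam * V * (1 - z) ≤
      (1 - β * lam) * (ε + 1 - V') + lam * V * (1 - z * V') := by
  have h1 : 0 ≤ (1 - β * lam) * (1 - V') := mul_nonneg (by linarith) (by linarith)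
  have h2 : 0 ≤ lam * V * (z * (1 - V')) := mul_nonneg (mul_nonneg hl0 hV) (mul_nonneg hz (by linarith))
  nlinarith [h1, h2]

/-- … and is therefore positive on the region (`0 < λ`, `0 < V`, `z < 1`, `0 ≤ ε`). -/
theorem neutral_coeff_pos {β z ε lam V V' : ℝ} (hl : β * lam ≤ 1) (hl0 : 0 < lam) (hV : 0 < V)
    (hV'1 : V' ≤ 1) (hz : 0 ≤ z) (hz1 : z < 1) (hε : 0 ≤ ε) :
    0 < (1 - β * lam) * (ε + 1 - V') + lam * V * (1 - z * V') := by
  have h := neutral_coeff_ge (ε := ε) hl hl0.le hV.le hV'1 hz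
  have : 0 < lam * V * (1 - z) := mul_pos (mul_pos hl0 hV) (by linarith)
  have : 0 ≤ (1 - β * lam) * ε := mul_nonneg (by linarith) hε
  linarith

/-! ## Concavity of `s ↦ s^κ` -/

/-- Tangent-at-one bound (Bernoulli): `x^κ ≤ 1 − κ(1−x)` for `x ≥ 0`, `0 ≤ κ ≤ 1`. -/
theorem rpow_tangent_one {x κ : ℝ} (hx : 0 ≤ x) (hκ0 : 0 ≤ κ) (hκ1 : κ ≤ 1) :
    x ^ κ ≤ 1 - κ * (1 - x) := by
  have h := rpow_one_add_le_one_add_mul_self (s := x - 1) (by linarith) hκ0 hκ1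
  have e : (1 : ℝ) + (x - 1) = x := by ring
  rw [e] at h
  linarith

/-- Tangent bound at `s₀ > 0`: `s^κ ≤ (1−κ)·s₀^κ + κ·s₀^{κ−1}·s` for `s ≥ 0`, `0 ≤ κ ≤ 1`. -/
theorem rpow_tangent {s s₀ κ : ℝ} (hs : 0 ≤ s) (hs0 : 0 < s₀) (hκ0 : 0 ≤ κ) (hκ1 : κ ≤ 1) :
    s ^ κ ≤ (1 - κ) * s₀ ^ κ + κ * s₀ ^ (κ - 1) * s := by
  have ht : s ^ κ = s₀ ^ κ * (s / s₀) ^ κ := by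
    rw [← mul_rpow hs0.le (div_nonneg hs hs0.le), mul_div_cancel₀ _ hs0.ne']
  have hB := rpow_tangent_one (div_nonneg hs hs0.le) hκ0 hκ1 (x := s / s₀) (κ := κ)
  have hpos : 0 ≤ s₀ ^ κ := rpow_nonneg hs0.le κ
  have h1 := mul_le_mul_of_nonneg_left hB hpos
  have e : s₀ ^ (κ - 1) = s₀ ^ κ / s₀ := rpow_sub_one hs0.ne' κ
  rw [ht, e]
  have : s₀ ^ κ * (1 - κ * (1 - s / s₀)) = (1 - κ) * s₀ ^ κ + κ * (s₀ ^ κ / s₀) * s := by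
    field_simp
    ring
  linarith [this]

/-! ## The strip bound -/

/-- **Strip bound.**  `A ≥ 0`, `B ≥ 0`, `0 ≤ κ ≤ 1`, `s₀ > 0` with `B ≤ A·s₀^{1−κ}` and
`(1−κ)·B·s₀^κ ≤ m`: then `A·x^κ + B·(1−x)^κ ≤ A + m` for every `x ∈ [0,1]`. -/
theorem strip_bound {A B κ s₀ m : ℝ} (hA : 0 ≤ A) (hB : 0 ≤ B) (hκ0 : 0 ≤ κ) (hκ1 : κ ≤ 1)
    (hs0 : 0 < s₀) (hdom : B ≤ A * s₀ ^ (1 - κ)) (hm : (1 - κ) * B * s₀ ^ κ ≤ m) :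
    ∀ x : ℝ, 0 ≤ x → x ≤ 1 → A * x ^ κ + B * (1 - x) ^ κ ≤ A + m := by
  intro x hx0 hx1
  have h1 := mul_le_mul_of_nonneg_left (rpow_tangent_one hx0 hκ0 hκ1) hA
  have h2 := mul_le_mul_of_nonneg_left
    (rpow_tangent (s := 1 - x) (by linarith) hs0 hκ0 hκ1) hB
  -- the linear terms: κ(1−x)·(B s₀^{κ−1} − A) ≤ 0
  have hk : B * s₀ ^ (κ - 1) ≤ A := by
    have e : s₀ ^ (1 - κ) * s₀ ^ (κ - 1) = 1 := by
      rw [← rpow_add hs0]; norm_num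
    have hpos : 0 ≤ s₀ ^ (κ - 1) := rpow_nonneg hs0.le _
    calc B * s₀ ^ (κ - 1) ≤ A * s₀ ^ (1 - κ) * s₀ ^ (κ - 1) :=
          mul_le_mul_of_nonneg_right hdom hpos
      _ = A := by rw [mul_assoc, e, mul_one]
  have h3 : κ * (1 - x) * (B * s₀ ^ (κ - 1) - A) ≤ 0 :=
    mul_nonpos_of_nonneg_of_nonpos (mul_nonneg hκ0 (by linarith)) (by linarith)
  have e2 : A * (1 - κ * (1 - x)) + B * ((1 - κ) * s₀ ^ κ + κ * s₀ ^ (κ - 1) * (1 - x)) =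
      A + (1 - κ) * B * s₀ ^ κ + κ * (1 - x) * (B * s₀ ^ (κ - 1) - A) := by ring
  linarith [h1, h2, e2, h3]

/-! ## The criterion on the neutral strip -/

/-- **The pair inequality of `RegionCriterion` on the neutral strip.**  For a pair of region points with
the product rule, if some `s₀ > 0` has `B ≤ A·s₀^{1−κ}` and `(1−κ)·B·s₀^κ ≤ λ'·c`
(`A, B, c` as in the file header), then the criterion's conclusion holds for this pair at every
`x ∈ [0,1]`.  Hypotheses kept minimal: `0 ≤ κ ≤ 1`, `A ≥ 0`, `B ≥ 0`. -/
theorem criterion_pair_of_strip {β z ε κ lam lam' V V' VP s₀ : ℝ} (hκ0 : 0 ≤ κ) (hκ1 : κ ≤ 1)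
    (hA : 0 ≤ (1 - (β - 1) * lam') * (lam * (ε + 1 - V)))
    (hB : 0 ≤ (1 - (β - 1) * lam) * (lam' * (ε + 1 - V')))
    (hP : VP * (lam + lam' - (2 * β - 1) * lam * lam') =
      lam' * (1 - β * lam) * V' + lam * (1 - β * lam') * V + z * lam * lam' * V * V')
    (hs0 : 0 < s₀)
    (hdom : (1 - (β - 1) * lam) * (lam' * (ε + 1 - V')) ≤
      (1 - (β - 1) * lam') * (lam * (ε + 1 - V)) * s₀ ^ (1 - κ))
    (hm : (1 - κ) * ((1 - (β - 1) * lam) * (lam' * (ε + 1 - V'))) * s₀ ^ κ ≤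
      lam' * ((1 - β * lam) * (ε + 1 - V') + lam * V * (1 - z * V'))) :
    ∀ x : ℝ, 0 ≤ x → x ≤ 1 →
      (1 - (β - 1) * lam') * (lam * (ε + 1 - V)) * x ^ κ +
          (1 - (β - 1) * lam) * (lam' * (ε + 1 - V')) * (1 - x) ^ κ ≤
        (lam + lam' - (2 * β - 1) * lam * lam') * (ε + 1 - VP) := by
  intro x hx0 hx1
  have h := strip_bound hA hB hκ0 hκ1 hs0 hdom hm x hx0 hx1
  have hid := neutral_identity (ε := ε) hP
  linarith

end Summit.MatrixMultiplication.MatrixMultiplication.Theorems.FarEdgeDescentNeutralMargin
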